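import Summits.ABC.IUTFork.Joshi.DictionaryThetaLoci
import Summits.ABC.IUTFork.Joshi.TensorPacketsJoshi
import HarnessLib

/-!
# Row D-09 MERGE: the loci reading `LociReading.proj` (abc-iut-E-t22) instantiated by the STRICTIFIED codomain of
# `Joshi/TensorPacketsJoshi.lean` (abc-iut-E-t20) — Joshi's `Θ̃^𝓘_Mochizuki` read in OUR packets IS its packet shadow

Dictionary file of the abc-iut cell, branch E (rung LADDER-ABC:A2.E; seat abc-iut-E-t22; plan/E/ASSIGNMENTS.md §3 merge-debt
«T-22 codomain = T-20», E-PLAN R14: Thm311-touching content in `Dictionary*` files; my RQ7 read of p429434, INFO 1: Joshi's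
codomain `𝓘^ℚ_Mochizuki = ∏_p ∏_{j=1}^{ℓ*} ^{S_{j+1}}𝓘^{ℚ_p}_p` ([J-III] = arXiv:2401.13508v4 (9.4.6.8), p.104 l.40–44) has factors only
at the labels `j ∈ {1, …, ℓ*} = T.LabelStar`, whereas S = `Cor312Vol.PilotKummerIndRelated`, `P.possibleImages` and the reading
`LociReading.proj` of `Joshi/DictionaryThetaLoci.lean` (p429683) range over ALL labels `j : T.Label` incl. `0`). **No side is
taken** on [IUTchIII] Cor. 3.12 or on any author; Joshi's papers are unrefereed preprints cited as such; typed ≠ proved; this file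
is dictionary BOOKKEEPING (logic only): no Joshi claim, no clause of Cor. 3.12 and no new candidate Prop is asserted.

WHAT IS HERE. E-t20's strictification (p429434, `TensorPacketDatum.ofLogShells`, Joshi (9.4.8.3) «forgetting the `y_j` …
altogether (as [Mochizuki, 2021a,b,c] does)», p.105 l.57–66) makes the codomain KERNEL-DEFINITIONALLY the product of our packets:
`𝔈.IQMochizukiAt ℚ (𝔈.ofLogShells S.L) z = ∀ (p : T.VQ) (j : T.LabelStar), S.L.Packet j.1 p` (`IQMochizukiAt_ofLogShells`, `rfl`).
Given ANY loci signature `C` (Thm-Def 9.8.1.1, `ATS3.TensorPacketLociDatum`) and an identification `e` of its tensor codomain `TM`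
with that product (data: how the abstract `TM` sits in E-t20's construction — the typer of §9.4 supplies it), `LociReading.ofStrict`
is the reading whose D-09 projection at a label `j ≠ 0` is THE COORDINATE `(p := v_ℚ, j)` and at `j = 0` is the junk value `0`
(there is no Joshi factor at `j = 0`; the Corollary's quantities read the labels of `𝔽_ℓ^⋇` only, `Setting.labelSucc`). PROVED:
at `j ≠ 0` my `locusRegion` IS E-t20's `packetShadows` of (the image of) Joshi's locus (`locusRegion_ofStrict`); at `j = 0` it is
`{0}` or `∅`; hence `LocusWithinHull` (labels of `𝔽_ℓ^⋇` only) is a statement about packet shadows alone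
(`locusWithinHull_ofStrict_iff`), while `LocusWithinPossibleImages` additionally asks the harmless `0 ∈ ⋃₀ possibleImages 0 v_ℚ`
at label `0` when the locus is non-empty (`locusWithinPossibleImages_ofStrict_iff`). The two D-09 typings agree; nothing else is
claimed. [claim: Joshi2024ATS3, status: disputed]
-/

noncomputable section

open Set

namespace Summit.ABC.IUTFork.Joshi

open Thm311 Cor312 Cor312Vol

variable {T : ThetaIndex} {S : LatticeSituation T} {P : Cor312.Setting S.toSituation}
  {W : Type} {V : W → Type} [∀ w, TopologicalSpace (V w)] {TJ TM : Type} [TopologicalSpace TJ] [TopologicalSpace TM]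
  {C : ATS3.TensorPacketLociDatum W V TJ TM} {𝔇 : Dictionary S} (𝔈 : TensorPacketDatum T)

namespace LociReading

/-- **The strictified reading** (row D-09 merge): Joshi's tensor codomain `TM` identified (by the datum `e`) with E-t20's
strictified `𝓘^ℚ_Mochizuki = ∏_{v_ℚ} ∏_{j ∈ 𝔽_ℓ^⋇} S.L.Packet j v_ℚ` (p429434 `IQMochizukiAt_ofLogShells`), projected to the packet
`(j, v_ℚ)` by its coordinate for `j ≠ 0` and by the junk value `0` at the label `0` (no Joshi factor there, [J-III] (9.4.6.8));
`pt` / `hpt` = the D-02 concordance of the Ansatz points. DATA ONLY. [claim: Joshi2024ATS3, status: disputed] -/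
def ofStrict (e : TM → 𝔈.IQMochizukiAt ℚ (𝔈.ofLogShells S.L) 𝔈.zTheta) (pt : C.Z → 𝔇.Pt) (hpt : pt C.zTheta = 𝔇.std) :
    LociReading P C 𝔇 where
  proj := fun j vQ t => if h : j = 0 then 0 else e t vQ ⟨j, h⟩
  pt := pt
  pt_zTheta := hpt

variable (e : TM → 𝔈.IQMochizukiAt ℚ (𝔈.ofLogShells S.L) 𝔈.zTheta) (pt : C.Z → 𝔇.Pt) (hpt : pt C.zTheta = 𝔇.std)

/-- **D-09 typings agree**: at a label `j ≠ 0`, Joshi's locus read by the strictified reading IS E-t20's packet shadow at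
`(v_ℚ, j)` of (the image under `e` of) the locus `Θ̃^𝓘_Mochizuki`. [folklore] -/
theorem locusRegion_ofStrict {j : T.Label} (hj : j ≠ 0) (vQ : T.VQ) :
    (ofStrict 𝔈 e pt hpt (P := P)).locusRegion j vQ = 𝔈.packetShadows (e '' C.thetaLocusTensorM) vQ ⟨j, hj⟩ := by
  simp only [locusRegion, ofStrict, dif_neg hj, TensorPacketDatum.packetShadows, image_image]
  rfl

/-- At the label `0` the strictified reading sees only the junk point `0`. [folklore] -/
theorem locusRegion_ofStrict_zero (vQ : T.VQ) : (ofStrict 𝔈 e pt hpt (P := P)).locusRegion 0 vQ ⊆ {0} := by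
  rintro x ⟨t, -, rfl⟩
  simp [ofStrict]

/-- … and exactly `{0}` when Joshi's locus is non-empty (it is: `thetaLocusJ_nonempty`'s Mochizuki analogue holds whenever a
collation of the standard tuple exists; stated here under the hypothesis). [folklore] -/
theorem locusRegion_ofStrict_zero_eq (h : C.thetaLocusTensorM.Nonempty) (vQ : T.VQ) :
    (ofStrict 𝔈 e pt hpt (P := P)).locusRegion 0 vQ = {0} := by
  refine (locusRegion_ofStrict_zero 𝔈 e pt hpt vQ).antisymm ?_
  rintro x rfl
  obtain ⟨t, ht⟩ := h
  exact ⟨t, ht, by simp [ofStrict]⟩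

/-- **The hull-level row reads packet shadows only**: `LocusWithinHull` for the strictified reading ⟺ at every label of `𝔽_ℓ^⋇`
the packet shadow of Joshi's locus lies in `^{n,∘}𝒰_{j,v_ℚ}`. [folklore] -/
theorem locusWithinHull_ofStrict_iff :
    (ofStrict 𝔈 e pt hpt (P := P)).LocusWithinHull ↔
      ∀ (i : Fin T.lstar) (vQ : T.VQ),
        𝔈.packetShadows (e '' C.thetaLocusTensorM) vQ ⟨Setting.labelSucc i, Setting.labelSucc_ne_zero i⟩ ⊆
          P.thetaHull (Setting.labelSucc i) vQ := by
  constructor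
  · intro h i vQ
    rw [← locusRegion_ofStrict 𝔈 e pt hpt (Setting.labelSucc_ne_zero i)]
    exact h i vQ
  · intro h i vQ
    rw [locusRegion_ofStrict 𝔈 e pt hpt (Setting.labelSucc_ne_zero i)]
    exact h i vQ

/-- **The identification-level row**: `LocusWithinPossibleImages` for the strictified reading ⟺ the packet shadows lie in the
union of the possible images at every label of `𝔽_ℓ^⋇`, AND (the junk label) `0 ∈ ⋃₀ possibleImages 0 v_ℚ` whenever Joshi's locus is
non-empty — the only trace of the label-0 mismatch between (9.4.6.8) and the all-labels quantifier of S. [folklore] -/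
theorem locusWithinPossibleImages_ofStrict_iff :
    (ofStrict 𝔈 e pt hpt (P := P)).LocusWithinPossibleImages ↔
      (∀ vQ : T.VQ, C.thetaLocusTensorM.Nonempty → (0 : S.L.Packet 0 vQ) ∈ ⋃₀ P.possibleImages 0 vQ) ∧
        ∀ (j : T.Label) (hj : j ≠ 0) (vQ : T.VQ),
          𝔈.packetShadows (e '' C.thetaLocusTensorM) vQ ⟨j, hj⟩ ⊆ ⋃₀ P.possibleImages j vQ := by
  constructor
  · intro h
    refine ⟨fun vQ hne => ?_, fun j hj vQ => ?_⟩
    · have h0 := h 0 vQ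
      rw [locusRegion_ofStrict_zero_eq 𝔈 e pt hpt hne] at h0
      exact h0 rfl
    · rw [← locusRegion_ofStrict 𝔈 e pt hpt hj]; exact h j vQ
  · rintro ⟨h0, h⟩ j vQ
    by_cases hj : j = 0
    · subst hj
      rintro x ⟨t, ht, rfl⟩
      show (ofStrict 𝔈 e pt hpt (P := P)).proj 0 vQ t ∈ _
      simp only [ofStrict, dite_true]
      exact h0 vQ ⟨t, ht⟩
    · rw [locusRegion_ofStrict 𝔈 e pt hpt hj]; exact h j hj vQ

/-- The label-0 side condition holds as soon as `0` lies in the (Ind3)-enlarged Θ-region at label `0` (every pinned naive model: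
the regions are balls `B_k ∋ 0`). [folklore] -/
theorem zero_mem_sUnion_possibleImages_of (vQ : T.VQ) (h : (0 : S.L.Packet 0 vQ) ∈ P.thetaRegion3 0 vQ) :
    (0 : S.L.Packet 0 vQ) ∈ ⋃₀ P.possibleImages 0 vQ :=
  subset_sUnion_of_mem (P.thetaRegion3_mem_possibleImages 0 vQ) h

end LociReading

end Summit.ABC.IUTFork.Joshi

end
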